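import Summits.QuantumFields.BalabanUV.Beta.GAN24.MonotoneBlocks
import Summits.QuantumFields.BalabanUV.Beta.GAN24.MonotoneLoewner

/-!
# Beta / GAN24 / MonotoneBlocksBalaban — (MONO-K)₂ for the ONE-STEP KKT BLOCKS over Bałaban's `k`-step `U(1)` effective fibre form
# `(QGQ*)⁻¹ = a·1 + D_k` ([B5] (1.66)/(1.99)/(1.102), t4-ne2 ∕ asym1 transcription), for ANY next-step constraint: Loewner chains along `n = Lc^j`
# and one-datum entrywise bands (gan24-p4 × gan24-p3 × asym1; BINDER-OWNERS row G-an2-4 ∕ (CONV-C), «rate OR monotonicity»; NOT IN PRINT — our proof attempt)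

HONEST FRAMING (page 1 of everything the β sub-cell writes): discharging `BetaPertH` makes Bałaban's UV stability UNCONDITIONAL — a
real constructive-QFT result; it is NOT the continuum limit and NOT the Clay problem.  HONEST DEPENDENCY (cell reorg 2026-08-19, verbatim):
«continuum YM on T⁴ ⇐ BetaPertH ∧ nine spine estimates (0/9 proved); BetaPertH ⇐ (D1) ∧ (D4) ∧ CAP+tail; G-an2-4 gates asym, D1 and NE2/3/4.»
HONEST LABEL: «not in print; our proof attempt; alternative discharge of the G-an2-4 row (rate OR monotonicity)»; 0 wall binders instantiated.

ABSOLUTE RULE (cell charter, verbatim): "No internally-minted statement may enter as a cited fact. Every hypothesis is either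
kernel-proved in this package or a verbatim quotation of a PUBLISHED theorem with page reference. The manuscript(s) under audit are
NOT citable for their own disputed steps — they are the thing under adjudication; programme-internal (2001/route/tribunal) claims
are never citable."  Nothing is cited as a hypothesis; [folklore] throughout (tree lemmas BY NAME).

## WHAT IS PROVED (V10 of `HOME/b2b-balaban-gan24-p4/MONOTONE.md`, for the U(1)-reduced presentation).  Let `E_j(p′) := qgqInv (Lc^j) a p′ =
a·1 + D^{(Lc^j)}(p′)` (asym1∕t4-ne2: the fibre matrix of `(QGQ*)⁻¹`, [B5] (1.102); `D` = the (1.66) form), `a > 0`, `p′ ≠ 0`.  Then `E_j` is Hermitian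
positive definite and INCREASES with `j` (asym1 `MonotoneScales.qform_qgqInv_mono`, re-read as Mathlib `PosSemidef`); hence, for EVERY constraint matrix
`Q` with independent rows (any next averaging step), by `GAN24/MonotoneBlocks`: the one-step fluctuation covariance `Γ(E_j, Q)` DECREASES, the
effective form `Δ_eff(E_j, Q)` INCREASES, the pivot and `E_j⁻¹ = QGQ*^{(Lc^j)}` DECREASE — Loewner chains along `j` (§2); and by
`GAN24/MonotoneLoewner.norm_sub_apply_le_of_steps` every entry of `Γ(E_j,Q) − Γ(E_{j'},Q)` (`j, j' ≥ k₀`) is bounded by ONE trace datum, UNCONDITIONALLY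
by the crude datum `d·a⁻¹` (`Γ ≤ E⁻¹ = QGQ* ≤ a⁻¹`, printed (1.100)) (§3).  This is (MONO-K)₂ for the `Γ`-block of a (1.17)-COMPOSING presentation —
what the β lane's weak-block-gauge KKT system would inherit IF it composed like (1.17) (p3's located term; nothing here asserts that).
-/

namespace Summit.QuantumFields.BalabanUV.Beta.GAN24.MonotoneBlocksBalaban

open scoped ComplexOrder ComplexConjugate Real
open Matrix
open Literature.MathematicalPhysics.QuantumFieldTheory.Balaban1983to89
open Literature.MathematicalPhysics.QuantumFieldTheory.Balaban1983to89.B5Prop11Fiber (d1Sym)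
open Literature.MathematicalPhysics.QuantumFieldTheory.Balaban1983to89.B5Bounds167Lattice (w166)
open Literature.MathematicalPhysics.QuantumFieldTheory.Balaban1983to89.B5QGQ199Rate (qform qgq qgqInv DeltaKfib qform_sub qform_qgqInv_lower
  qgqInv_mul_qgq)
open Literature.MathematicalPhysics.QuantumFieldTheory.Balaban1983to89.Beta.MonotoneScales (qform_qgqInv_mono)
open Summit.QuantumFields.BalabanUV.Beta.PropagatorWoodburyFibre (pivot effForm flucCov pivot_posDef effForm_posDef isUnit_pivot_of_posDef)
open Summit.QuantumFields.BalabanUV.Beta.GAN24.MonotoneLoewner (qform_eq_star_dotProduct_mulVec posSemidef_of_isHermitian_re_nonneg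
  norm_sub_apply_le_of_steps monotoneTailDown_re_trace re_trace_qgq_bounds)
open Summit.QuantumFields.BalabanUV.Beta.GAN24.MonotoneBlocks (inv_antitone pivot_antitone effForm_monotone flucCov_antitone)
open Summit.QuantumFields.BalabanUV.Beta.CapRowsTail (MonotoneTailDown)

variable {d : ℕ}

/-! ## §1 The `k`-step effective fibre form `E = a·1 + D_k` is Hermitian positive definite and increases with the scale -/

/-- the (1.66) weight is symmetric in its two indices. [folklore] -/
theorem w166_symm (n : ℕ) (μ ν : Fin d) (s : Fin d → ℝ) : w166 n μ ν s = w166 n ν μ s := by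
  unfold w166; ring

/-- the (1.66) fibre matrix `D_k(p′)` is Hermitian. [folklore] -/
theorem DeltaKfib_isHermitian (n : ℕ) (s : Fin d → ℝ) : (DeltaKfib n s).IsHermitian := by
  apply Matrix.IsHermitian.ext
  intro i j
  simp only [DeltaKfib]
  by_cases h : i = j
  · subst h
    simp only [if_true, Complex.star_def, map_sub, map_mul, Complex.conj_ofReal, Complex.conj_conj]
    ring
  · have h' : j ≠ i := Ne.symm h
    simp only [h, h', if_false, Complex.star_def, map_sub, map_mul, map_zero, Complex.conj_ofReal, Complex.conj_conj,
      w166_symm n j i]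
    ring

/-- `E = a·1 + D_k` is Hermitian. [folklore] -/
theorem qgqInv_isHermitian (n : ℕ) (a : ℝ) (s : Fin d → ℝ) : (qgqInv n a s).IsHermitian := by
  unfold qgqInv
  refine Matrix.IsHermitian.add ?_ (DeltaKfib_isHermitian n s)
  rw [Matrix.IsHermitian, conjTranspose_smul, conjTranspose_one, Complex.star_def, Complex.conj_ofReal]

/-- `E = a·1 + D_k` is positive definite for `a > 0`, `p′ ≠ 0` (t4-ne2's `qform_qgqInv_lower`: `⟨w,Ew⟩ ≥ a‖w‖²`). [folklore] -/
theorem qgqInv_posDef (n : ℕ) [NeZero n] (hn : 1 ≤ n) (a : ℝ) (ha : 0 < a) (s : Fin d → ℝ) (hs : ∀ κ, |s κ| ≤ π)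
    (ν₀ : Fin d) (hν₀ : s ν₀ ≠ 0) : (qgqInv n a s).PosDef := by
  refine Matrix.PosDef.of_dotProduct_mulVec_pos (qgqInv_isHermitian n a s) fun x hx => ?_
  obtain ⟨hre, him⟩ := qform_qgqInv_lower n hn a s hs ν₀ hν₀ x
  rw [qform_eq_star_dotProduct_mulVec] at hre him
  have hpos : 0 < ∑ μ, ‖x μ‖ ^ 2 := by
    obtain ⟨μ, hμ⟩ := Function.ne_iff.mp hx
    exact lt_of_lt_of_le (by positivity : 0 < ‖x μ‖ ^ 2)
      (Finset.single_le_sum (f := fun μ => ‖x μ‖ ^ 2) (fun i _ => sq_nonneg _) (Finset.mem_univ μ))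
  rw [Complex.pos_iff]
  exact ⟨lt_of_lt_of_le (mul_pos ha hpos) hre, him.symm⟩

section Refine

variable {N R : ℕ} [NeZero N] [NeZero R]

/-- **`E` INCREASES UNDER AVERAGING**: `E^{(RN)} − E^{(N)}` is PSD (asym1's `qform_qgqInv_mono` as Mathlib `PosSemidef`). [folklore] -/
theorem posSemidef_qgqInv_refine_sub (hN : 1 ≤ N) (hR : 1 ≤ R) (a : ℝ) (s : Fin d → ℝ) (hs : ∀ κ, |s κ| ≤ π)
    (ν₀ : Fin d) (hν₀ : s ν₀ ≠ 0) : (qgqInv (R * N) a s - qgqInv N a s).PosSemidef := by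
  refine posSemidef_of_isHermitian_re_nonneg ((qgqInv_isHermitian (R * N) a s).sub (qgqInv_isHermitian N a s)) fun w => ?_
  rw [← qform_eq_star_dotProduct_mulVec, qform_sub, Complex.sub_re, sub_nonneg]
  exact qform_qgqInv_mono hN hR a s hs ν₀ hν₀ w

end Refine

/-- … along powers of the block size: `E^{(Lc^{j+i})} − E^{(Lc^j)}` is PSD. [folklore] -/
theorem posSemidef_qgqInv_pow_sub (Lc : ℕ) [NeZero Lc] (a : ℝ) (s : Fin d → ℝ) (hs : ∀ κ, |s κ| ≤ π) (ν₀ : Fin d)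
    (hν₀ : s ν₀ ≠ 0) (j i : ℕ) : (qgqInv (Lc ^ (j + i)) a s - qgqInv (Lc ^ j) a s).PosSemidef := by
  have hj : 1 ≤ Lc ^ j := Nat.one_le_iff_ne_zero.mpr (NeZero.ne _)
  have hi : 1 ≤ Lc ^ i := Nat.one_le_iff_ne_zero.mpr (NeZero.ne _)
  have h := posSemidef_qgqInv_refine_sub (N := Lc ^ j) (R := Lc ^ i) hj hi a s hs ν₀ hν₀
  convert h using 4
  rw [pow_add, mul_comm]

/-- `Γ(H, Q) ≤ H⁻¹`: the subtracted term `H⁻¹Qᴴ Δ_eff Q H⁻¹ = (H⁻¹Qᴴ) Δ_eff (H⁻¹Qᴴ)ᴴ` is PSD. [folklore] -/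
theorem inv_sub_flucCov_posSemidef {m : Type*} [Fintype m] [DecidableEq m] {H : Matrix (Fin d) (Fin d) ℂ} (hH : H.PosDef)
    (Q : Matrix m (Fin d) ℂ) (hQ : Function.Injective Q.vecMul) : (H⁻¹ - flucCov H Q).PosSemidef := by
  have hΔ := (effForm_posDef hH hQ).posSemidef.mul_mul_conjTranspose_same (H⁻¹ * Qᴴ)
  have e : H⁻¹ - flucCov H Q = H⁻¹ * Qᴴ * effForm H Q * (H⁻¹ * Qᴴ)ᴴ := by
    rw [flucCov, sub_sub_cancel, conjTranspose_mul, conjTranspose_conjTranspose, hH.isHermitian.inv, Matrix.mul_assoc]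
  rwa [e]

/-! ## §2 The one-step blocks over `E_j` are Loewner chains along `j`, for ANY next-step constraint `Q` with independent rows -/

section Chains

variable (Lc : ℕ) [NeZero Lc] {a : ℝ} (ha : 0 < a) {s : Fin d → ℝ} (hs : ∀ κ, |s κ| ≤ π) (ν₀ : Fin d) (hν₀ : s ν₀ ≠ 0)
  {m : Type*} [Fintype m] [DecidableEq m] {Q : Matrix m (Fin d) ℂ} (hQ : Function.Injective Q.vecMul)

include ha hs hν₀

/-- `E_j` at the scale `Lc^j` is positive definite. [folklore] -/
theorem qgqInv_pow_posDef (j : ℕ) : (qgqInv (Lc ^ j) a s).PosDef :=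
  qgqInv_posDef (Lc ^ j) (Nat.one_le_iff_ne_zero.mpr (NeZero.ne _)) a ha s hs ν₀ hν₀

/-- **`QGQ* = E⁻¹` DECREASES** along `j` (the inverse is antitone). [folklore] -/
theorem inv_step (j : ℕ) : ((qgqInv (Lc ^ j) a s)⁻¹ - (qgqInv (Lc ^ (j + 1)) a s)⁻¹).PosSemidef :=
  inv_antitone (qgqInv_pow_posDef Lc ha hs ν₀ hν₀ j) (qgqInv_pow_posDef Lc ha hs ν₀ hν₀ (j + 1))
    (posSemidef_qgqInv_pow_sub Lc a s hs ν₀ hν₀ j 1)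

include hQ

/-- **THE ONE-STEP FLUCTUATION COVARIANCE `Γ(E_j, Q)` DECREASES** along `j`. [folklore] -/
theorem flucCov_step (j : ℕ) : (flucCov (qgqInv (Lc ^ j) a s) Q - flucCov (qgqInv (Lc ^ (j + 1)) a s) Q).PosSemidef :=
  flucCov_antitone (qgqInv_pow_posDef Lc ha hs ν₀ hν₀ j) (qgqInv_pow_posDef Lc ha hs ν₀ hν₀ (j + 1))
    (posSemidef_qgqInv_pow_sub Lc a s hs ν₀ hν₀ j 1) hQ

/-- **THE ONE-STEP EFFECTIVE FORM `Δ_eff(E_j, Q)` INCREASES** along `j`. [folklore] -/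
theorem effForm_step (j : ℕ) : (effForm (qgqInv (Lc ^ (j + 1)) a s) Q - effForm (qgqInv (Lc ^ j) a s) Q).PosSemidef :=
  effForm_monotone (qgqInv_pow_posDef Lc ha hs ν₀ hν₀ j) (qgqInv_pow_posDef Lc ha hs ν₀ hν₀ (j + 1))
    (posSemidef_qgqInv_pow_sub Lc a s hs ν₀ hν₀ j 1) hQ

omit [DecidableEq m] hQ in
/-- **THE ONE-STEP PIVOT `Q E_j⁻¹ Qᴴ` DECREASES** along `j`. [folklore] -/
theorem pivot_step (Q : Matrix m (Fin d) ℂ) (j : ℕ) : (pivot (qgqInv (Lc ^ j) a s) Q - pivot (qgqInv (Lc ^ (j + 1)) a s) Q).PosSemidef :=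
  pivot_antitone (qgqInv_pow_posDef Lc ha hs ν₀ hν₀ j) (qgqInv_pow_posDef Lc ha hs ν₀ hν₀ (j + 1))
    (posSemidef_qgqInv_pow_sub Lc a s hs ν₀ hν₀ j 1) Q

/-! ## §3 (MONO-K)₂ for the `Γ`- and `Δ_eff`-blocks: one trace datum; the crude datum for `Γ` -/

/-- **(MONO-K)₂ FOR THE `Γ`-BLOCK, ONE TRACE DATUM**: if the trace of `Γ(E_j, Q)` lost after `k₀` is at most `η₀`, every entry of
`Γ(E_j,Q) − Γ(E_{j'},Q)` (`j, j' ≥ k₀`) has norm `≤ η₀`; the trace majorant is non-increasing (an5's socket). [folklore] -/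
theorem flucCov_entry_dev_le {k₀ : ℕ} {η₀ : ℝ}
    (hdat : ∀ j, k₀ ≤ j → (flucCov (qgqInv (Lc ^ k₀) a s) Q - flucCov (qgqInv (Lc ^ j) a s) Q).trace.re ≤ η₀) :
    (∀ j j', k₀ ≤ j → k₀ ≤ j' → ∀ μ ν, ‖(flucCov (qgqInv (Lc ^ j) a s) Q - flucCov (qgqInv (Lc ^ j') a s) Q) μ ν‖ ≤ η₀) ∧
      MonotoneTailDown (fun j => (flucCov (qgqInv (Lc ^ j) a s) Q).trace.re) 0 :=
  ⟨norm_sub_apply_le_of_steps (P := fun j => flucCov (qgqInv (Lc ^ j) a s) Q) (fun j _ => flucCov_step Lc ha hs ν₀ hν₀ hQ j) hdat,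
    monotoneTailDown_re_trace (P := fun j => flucCov (qgqInv (Lc ^ j) a s) Q) fun j _ => flucCov_step Lc ha hs ν₀ hν₀ hQ j⟩

/-- **(MONO-K)₂ FOR THE `Δ_eff`-BLOCK, ONE TRACE DATUM** (increasing chain: the datum bounds the trace GAINED after `k₀`). [folklore] -/
theorem effForm_entry_dev_le {k₀ : ℕ} {η₀ : ℝ}
    (hdat : ∀ j, k₀ ≤ j → (effForm (qgqInv (Lc ^ j) a s) Q - effForm (qgqInv (Lc ^ k₀) a s) Q).trace.re ≤ η₀) :
    ∀ j j', k₀ ≤ j → k₀ ≤ j' → ∀ μ ν, ‖(effForm (qgqInv (Lc ^ j) a s) Q - effForm (qgqInv (Lc ^ j') a s) Q) μ ν‖ ≤ η₀ := by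
  have h := norm_sub_apply_le_of_steps (P := fun j => -effForm (qgqInv (Lc ^ j) a s) Q)
    (fun j _ => by simpa [neg_sub_neg, sub_eq_add_neg, add_comm] using effForm_step Lc ha hs ν₀ hν₀ hQ j)
    (η₀ := η₀) (fun j hj => by simpa [neg_sub_neg, sub_eq_add_neg, add_comm] using hdat j hj)
  intro j j' hj hj' μ ν
  convert h j' j hj' hj μ ν using 2
  simp only [Matrix.sub_apply, Matrix.neg_apply]
  ring

omit hQ in
/-- `E_j⁻¹ = QGQ*^{(Lc^j)}` (t4-ne2's `qgqInv_mul_qgq`). [folklore] -/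
theorem qgqInv_pow_inv (j : ℕ) : (qgqInv (Lc ^ j) a s)⁻¹ = qgq (Lc ^ j) a s := by
  have hj : 1 ≤ Lc ^ j := Nat.one_le_iff_ne_zero.mpr (NeZero.ne _)
  exact Matrix.inv_eq_right_inv (qgqInv_mul_qgq (Lc ^ j) hj a ha s hs ν₀ hν₀).1

/-- **THE CRUDE TRACE DATUM FOR `Γ`**: `0 ≤ re tr Γ(E_j, Q) ≤ d·a⁻¹` (from `Γ ≤ E⁻¹ = QGQ* ≤ a⁻¹`, printed (1.100)). [folklore] -/
theorem re_trace_flucCov_bounds (j : ℕ) :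
    0 ≤ (flucCov (qgqInv (Lc ^ j) a s) Q).trace.re ∧ (flucCov (qgqInv (Lc ^ j) a s) Q).trace.re ≤ d * a⁻¹ := by
  have hj : 1 ≤ Lc ^ j := Nat.one_le_iff_ne_zero.mpr (NeZero.ne _)
  have hE := qgqInv_pow_posDef Lc ha hs ν₀ hν₀ j
  have h1 := (Summit.QuantumFields.BalabanUV.Beta.PropagatorWoodburyFibre.flucCov_posSemidef hE hQ).trace_nonneg
  have h2 := (inv_sub_flucCov_posSemidef hE Q hQ).trace_nonneg
  rw [Complex.nonneg_iff] at h1 h2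
  rw [Matrix.trace_sub, Complex.sub_re, qgqInv_pow_inv Lc ha hs ν₀ hν₀ j] at h2
  have h3 := (re_trace_qgq_bounds (Lc ^ j) hj a ha s hs ν₀ hν₀).2
  exact ⟨h1.1, by linarith [h2.1]⟩

/-- **(MONO-K)₂ FOR THE `Γ`-BLOCK, UNCONDITIONALLY** (crude datum `d·a⁻¹`): for every next-step constraint `Q` with independent rows, `a > 0`,
`p′ ≠ 0` and ALL `j, j'`, every entry of `Γ(E_j,Q) − Γ(E_{j'},Q)` has norm at most `d·a⁻¹`. [folklore] -/
theorem flucCov_entry_dev_le_crude : ∀ j j' (μ ν : Fin d),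
    ‖(flucCov (qgqInv (Lc ^ j) a s) Q - flucCov (qgqInv (Lc ^ j') a s) Q) μ ν‖ ≤ d * a⁻¹ := by
  intro j j' μ ν
  refine (flucCov_entry_dev_le Lc ha hs ν₀ hν₀ hQ (k₀ := 0) fun i _ => ?_).1 j j' (Nat.zero_le _) (Nat.zero_le _) μ ν
  have h0 := re_trace_flucCov_bounds Lc ha hs ν₀ hν₀ hQ 0
  have hi := re_trace_flucCov_bounds Lc ha hs ν₀ hν₀ hQ i
  rw [Matrix.trace_sub, Complex.sub_re]
  linarith [h0.2, hi.1]

end Chains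

end Summit.QuantumFields.BalabanUV.Beta.GAN24.MonotoneBlocksBalaban
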